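import Summits.BirchSwinnertonDyer.BirchSwinnertonDyer.Theorems.ManinLocalTwoThreeEtaLimitsSeventyTwo
import Literature.NumberTheory.EllipticCurves.ModularCurveSturmProofs
import HarnessLib

/-!
# Level 72, the level-36 players: `𝓔 = x − 1` is `Γ₀(36)`-invariant; the `η`-quotients `A, B, C₁, …, C₆` and the Eisenstein
# combinations `G, G_y` are in `M₂(Γ₀(36))`; Sturm's bound `F = o(q¹³) ⟹ F = 0` in `M₂(Γ₀(36))`

Cell bsd-f2-manin, route `ManinLocalTwoThree` (cruxes C2 `ManinOddAtFour` stmt-22967: `2² ∣ 72`, AND C3 `ManinPrimeToThreeAtNine`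
stmt-22968: `3² ∣ 72`; genus `5`), prover seat p3 gen 24; the modular-form side of the "E₂ road" to the `η`-identities of
`X₀(72) → 72a1` (`EtaLogDerivativeForms`, `EulerRemaindersSeventyTwo`, `EtaQuotientsSeventyTwo`; identities in the sequel
`…EtaIdentitiesSeventyTwo`).  Objects: `𝓔 = η₂η₄/(η₁₈η₃₆)` (weight `0`), `A = h₁y/𝓔`, `B = h₂y/𝓔`, `Cᵢ ∈ {h₁, h₂}·{1, 𝓔, 𝓔²}/y`
(weight `2`), `G = 2E₂(2τ) + 4E₂(4τ) − 18E₂(18τ) − 36E₂(36τ)` and `G_y = 12E₂(6τ) + 24E₂(12τ) − 36E₂(18τ) − 72E₂(36τ)` (the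
logarithmic derivatives of `𝓔` and `y = η₆²η₁₂²/(η₁₈²η₃₆²)`, times `12/(πi)`).

* §1 Newman's conditions (decidable, with the square witnesses) and Ligozat's non-negativity at all nine cusp classes of `Γ₀(36)`
  (decidable) make `A, B, C₁, …, C₆` HOLOMORPHIC modular forms of weight `2` (tree `etaQuotientModularForm`); `G, G_y ∈ M₂(Γ₀(36))`
  by `EtaLogDerivativeForms.exists_modularForm_e2Comb` (`Σ r_δ = 0`);
* §2 Sturm: `F ∈ M₂(Γ₀(36))` with `F/q¹³ → 0` vanishes (`⌊2·72/12⌋ = 12 < 13`, tree `coe_eq_zero_of_isBigO_exp'`, `gamma0_data_36`).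

HONEST FRAMING: unconditional bookkeeping; nothing here proves C2, C3, Manin's conjecture or BSD; items 22967/22968 stay OPEN.
No definition, no named fact, no sorry. [cite: Ligozat1975, Ch. 3] [cite: DiamondShurman2005, §1.2, Thm. 3.5.1] [cite: Zagier2008, §2.3]
-/

set_option autoImplicit false
-- lint-debt: the directory name repeats the summit name (sibling precedent `ManinLocalTwoThreeNewformSeventyTwo.lean`)
set_option linter.dupNamespace false

noncomputable section

open Complex Filter Topology Set Asymptotics Polynomial EisensteinSeries
open UpperHalfPlane hiding I
open scoped Real Topology Manifold MatrixGroups ModularForm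
open ModularForm CongruenceSubgroup
open Literature.NumberTheory.ModularForms
open Literature.NumberTheory.EllipticCurves Literature.NumberTheory.EllipticCurves.ModularForms

namespace Summit.BirchSwinnertonDyer.BirchSwinnertonDyer.Theorems.ManinLocalTwoThree.LevelThirtySixFormsSeventyTwo

open QRemainder EulerRemainders EulerRemaindersSeventyTwo EtaQuotientsSeventyTwo EtaLimitsSeventyTwo EtaLogDerivativeForms

/-! ## §1 The level-`36` players: `𝓔` is `Γ₀(36)`-invariant; `A, B, C₁, …, C₆ ∈ M₂(Γ₀(36))`; `G, G_y ∈ M₂(Γ₀(36))` -/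

/-- Newman's conditions for `𝓔 = η₂η₄/(η₁₈η₃₆)` in weight `0` at level `36` (`∏ δ^{|r|} = 72²`). [cite: Ligozat1975, Ch. 3] -/
theorem newmanCond_E : NewmanCond 36 (expFn [(2, 1), (4, 1), (18, -1), (36, -1)]) 0 :=
  ⟨by decide, by decide, by decide, ⟨72, by decide⟩⟩

/-- **`𝓔(γτ) = 𝓔(τ)` for `γ ∈ Γ₀(36)`** (so `x = 1 + 𝓔` is a function on `X₀(36)`, a fortiori on `X₀(72)`). [cite: Ligozat1975, Ch. 3] -/
theorem E_smul {γ : SL(2, ℤ)} (hγ : γ ∈ Gamma0 36) (τ : ℍ) : etaQuotient 36 (expFn [(2, 1), (4, 1), (18, -1), (36, -1)]) (γ • τ) = etaQuotient 36 (expFn [(2, 1), (4, 1), (18, -1), (36, -1)]) τ := by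
  simpa using etaQuotient_smul_of_mem_Gamma0 36 (by norm_num) (expFn [(2, 1), (4, 1), (18, -1), (36, -1)]) 0 Even.zero newmanCond_E hγ τ

/-- `x = 1 + 𝓔` is `Γ₀(72)`-invariant. [folklore] -/
theorem x_smul72 (γ : Gamma0 72) (τ : ℍ) : 1 + etaQuotient 36 (expFn [(2, 1), (4, 1), (18, -1), (36, -1)]) ((γ : SL(2, ℤ)) • τ) = 1 + etaQuotient 36 (expFn [(2, 1), (4, 1), (18, -1), (36, -1)]) τ := by
  rw [E_smul (mem_Gamma0_of_dvd_level (by norm_num : 36 ∣ 72) γ.2) τ]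

/-- Newman's conditions for `A` in weight `2` at level `36` (`∏ δ^{|r_δ|} = 248832²`). [cite: Ligozat1975, Ch. 3] -/
theorem newmanCond_A : NewmanCond 36 (expFn [(2, -3), (4, 3), (6, 4), (12, 2), (18, -1), (36, -1)]) 2 :=
  ⟨by decide, by decide, by decide, ⟨248832, by decide⟩⟩

/-- Ligozat's orders of `A` at the cusps of `Γ₀(36)` are `≥ 0`: `A` is HOLOMORPHIC. [cite: Ligozat1975, Ch. 3] -/
theorem cuspOrder24_nonneg_A : ∀ t ∈ (36 : ℕ).divisors, 0 ≤ cuspOrder24 36 (expFn [(2, -3), (4, 3), (6, 4), (12, 2), (18, -1), (36, -1)]) t := by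
  decide

/-- **`A ∈ M₂(Γ₀(36))`.** [cite: Ligozat1975, Ch. 3] -/
theorem exists_modularForm_A : ∃ F : ModularForm (Gamma0 36) 2, ⇑F = etaQuotient 36 (expFn [(2, -3), (4, 3), (6, 4), (12, 2), (18, -1), (36, -1)]) :=
  ⟨etaQuotientModularForm 36 _ 2 (by decide) newmanCond_A cuspOrder24_nonneg_A, rfl⟩

/-- Newman's conditions for `B` in weight `2` at level `36` (`∏ δ^{|r_δ|} = 497664²`). [cite: Ligozat1975, Ch. 3] -/
theorem newmanCond_B : NewmanCond 36 (expFn [(2, 3), (4, -3), (6, 2), (12, 4), (18, -1), (36, -1)]) 2 :=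
  ⟨by decide, by decide, by decide, ⟨497664, by decide⟩⟩

/-- Ligozat's orders of `B` at the cusps of `Γ₀(36)` are `≥ 0`: `B` is HOLOMORPHIC. [cite: Ligozat1975, Ch. 3] -/
theorem cuspOrder24_nonneg_B : ∀ t ∈ (36 : ℕ).divisors, 0 ≤ cuspOrder24 36 (expFn [(2, 3), (4, -3), (6, 2), (12, 4), (18, -1), (36, -1)]) t := by
  decide

/-- **`B ∈ M₂(Γ₀(36))`.** [cite: Ligozat1975, Ch. 3] -/
theorem exists_modularForm_B : ∃ F : ModularForm (Gamma0 36) 2, ⇑F = etaQuotient 36 (expFn [(2, 3), (4, -3), (6, 2), (12, 4), (18, -1), (36, -1)]) :=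
  ⟨etaQuotientModularForm 36 _ 2 (by decide) newmanCond_B cuspOrder24_nonneg_B, rfl⟩

/-- Newman's conditions for `C1` in weight `2` at level `36` (`∏ δ^{|r_δ|} = 248832²`). [cite: Ligozat1975, Ch. 3] -/
theorem newmanCond_C1 : NewmanCond 36 (expFn [(2, -2), (4, 4), (12, -2), (18, 2), (36, 2)]) 2 :=
  ⟨by decide, by decide, by decide, ⟨248832, by decide⟩⟩

/-- Ligozat's orders of `C1` at the cusps of `Γ₀(36)` are `≥ 0`: `C1` is HOLOMORPHIC. [cite: Ligozat1975, Ch. 3] -/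
theorem cuspOrder24_nonneg_C1 : ∀ t ∈ (36 : ℕ).divisors, 0 ≤ cuspOrder24 36 (expFn [(2, -2), (4, 4), (12, -2), (18, 2), (36, 2)]) t := by
  decide

/-- **`C1 ∈ M₂(Γ₀(36))`.** [cite: Ligozat1975, Ch. 3] -/
theorem exists_modularForm_C1 : ∃ F : ModularForm (Gamma0 36) 2, ⇑F = etaQuotient 36 (expFn [(2, -2), (4, 4), (12, -2), (18, 2), (36, 2)]) :=
  ⟨etaQuotientModularForm 36 _ 2 (by decide) newmanCond_C1 cuspOrder24_nonneg_C1, rfl⟩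

/-- Newman's conditions for `C2` in weight `2` at level `36` (`∏ δ^{|r_δ|} = 62208²`). [cite: Ligozat1975, Ch. 3] -/
theorem newmanCond_C2 : NewmanCond 36 (expFn [(2, 4), (4, -2), (6, -2), (18, 2), (36, 2)]) 2 :=
  ⟨by decide, by decide, by decide, ⟨62208, by decide⟩⟩

/-- Ligozat's orders of `C2` at the cusps of `Γ₀(36)` are `≥ 0`: `C2` is HOLOMORPHIC. [cite: Ligozat1975, Ch. 3] -/
theorem cuspOrder24_nonneg_C2 : ∀ t ∈ (36 : ℕ).divisors, 0 ≤ cuspOrder24 36 (expFn [(2, 4), (4, -2), (6, -2), (18, 2), (36, 2)]) t := by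
  decide

/-- **`C2 ∈ M₂(Γ₀(36))`.** [cite: Ligozat1975, Ch. 3] -/
theorem exists_modularForm_C2 : ∃ F : ModularForm (Gamma0 36) 2, ⇑F = etaQuotient 36 (expFn [(2, 4), (4, -2), (6, -2), (18, 2), (36, 2)]) :=
  ⟨etaQuotientModularForm 36 _ 2 (by decide) newmanCond_C2 cuspOrder24_nonneg_C2, rfl⟩

/-- Newman's conditions for `C3` in weight `2` at level `36` (`∏ δ^{|r_δ|} = 13824²`). [cite: Ligozat1975, Ch. 3] -/
theorem newmanCond_C3 : NewmanCond 36 (expFn [(2, -1), (4, 5), (12, -2), (18, 1), (36, 1)]) 2 :=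
  ⟨by decide, by decide, by decide, ⟨13824, by decide⟩⟩

/-- Ligozat's orders of `C3` at the cusps of `Γ₀(36)` are `≥ 0`: `C3` is HOLOMORPHIC. [cite: Ligozat1975, Ch. 3] -/
theorem cuspOrder24_nonneg_C3 : ∀ t ∈ (36 : ℕ).divisors, 0 ≤ cuspOrder24 36 (expFn [(2, -1), (4, 5), (12, -2), (18, 1), (36, 1)]) t := by
  decide

/-- **`C3 ∈ M₂(Γ₀(36))`.** [cite: Ligozat1975, Ch. 3] -/
theorem exists_modularForm_C3 : ∃ F : ModularForm (Gamma0 36) 2, ⇑F = etaQuotient 36 (expFn [(2, -1), (4, 5), (12, -2), (18, 1), (36, 1)]) :=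
  ⟨etaQuotientModularForm 36 _ 2 (by decide) newmanCond_C3 cuspOrder24_nonneg_C3, rfl⟩

/-- Newman's conditions for `C4` in weight `2` at level `36` (`∏ δ^{|r_δ|} = 1728²`). [cite: Ligozat1975, Ch. 3] -/
theorem newmanCond_C4 : NewmanCond 36 (expFn [(2, 5), (4, -1), (6, -2), (18, 1), (36, 1)]) 2 :=
  ⟨by decide, by decide, by decide, ⟨1728, by decide⟩⟩

/-- Ligozat's orders of `C4` at the cusps of `Γ₀(36)` are `≥ 0`: `C4` is HOLOMORPHIC. [cite: Ligozat1975, Ch. 3] -/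
theorem cuspOrder24_nonneg_C4 : ∀ t ∈ (36 : ℕ).divisors, 0 ≤ cuspOrder24 36 (expFn [(2, 5), (4, -1), (6, -2), (18, 1), (36, 1)]) t := by
  decide

/-- **`C4 ∈ M₂(Γ₀(36))`.** [cite: Ligozat1975, Ch. 3] -/
theorem exists_modularForm_C4 : ∃ F : ModularForm (Gamma0 36) 2, ⇑F = etaQuotient 36 (expFn [(2, 5), (4, -1), (6, -2), (18, 1), (36, 1)]) :=
  ⟨etaQuotientModularForm 36 _ 2 (by decide) newmanCond_C4 cuspOrder24_nonneg_C4, rfl⟩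

/-- Newman's conditions for `C5` in weight `2` at level `36` (`∏ δ^{|r_δ|} = 768²`). [cite: Ligozat1975, Ch. 3] -/
theorem newmanCond_C5 : NewmanCond 36 (expFn [(4, 6), (12, -2)]) 2 :=
  ⟨by decide, by decide, by decide, ⟨768, by decide⟩⟩

/-- Ligozat's orders of `C5` at the cusps of `Γ₀(36)` are `≥ 0`: `C5` is HOLOMORPHIC. [cite: Ligozat1975, Ch. 3] -/
theorem cuspOrder24_nonneg_C5 : ∀ t ∈ (36 : ℕ).divisors, 0 ≤ cuspOrder24 36 (expFn [(4, 6), (12, -2)]) t := by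
  decide

/-- **`C5 ∈ M₂(Γ₀(36))`.** [cite: Ligozat1975, Ch. 3] -/
theorem exists_modularForm_C5 : ∃ F : ModularForm (Gamma0 36) 2, ⇑F = etaQuotient 36 (expFn [(4, 6), (12, -2)]) :=
  ⟨etaQuotientModularForm 36 _ 2 (by decide) newmanCond_C5 cuspOrder24_nonneg_C5, rfl⟩

/-- Newman's conditions for `C6` in weight `2` at level `36` (`∏ δ^{|r_δ|} = 48²`). [cite: Ligozat1975, Ch. 3] -/
theorem newmanCond_C6 : NewmanCond 36 (expFn [(2, 6), (6, -2)]) 2 :=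
  ⟨by decide, by decide, by decide, ⟨48, by decide⟩⟩

/-- Ligozat's orders of `C6` at the cusps of `Γ₀(36)` are `≥ 0`: `C6` is HOLOMORPHIC. [cite: Ligozat1975, Ch. 3] -/
theorem cuspOrder24_nonneg_C6 : ∀ t ∈ (36 : ℕ).divisors, 0 ≤ cuspOrder24 36 (expFn [(2, 6), (6, -2)]) t := by
  decide

/-- **`C6 ∈ M₂(Γ₀(36))`.** [cite: Ligozat1975, Ch. 3] -/
theorem exists_modularForm_C6 : ∃ F : ModularForm (Gamma0 36) 2, ⇑F = etaQuotient 36 (expFn [(2, 6), (6, -2)]) :=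
  ⟨etaQuotientModularForm 36 _ 2 (by decide) newmanCond_C6 cuspOrder24_nonneg_C6, rfl⟩

/-- `Σ_{δ∣36} r_δ(𝓔) = 0` read in `ℂ`. [folklore] -/
theorem sum_expFn_E_cast : ∑ δ ∈ (36 : ℕ).divisors, ((expFn [(2, 1), (4, 1), (18, -1), (36, -1)] δ : ℤ) : ℂ) = 0 := by
  rw [← Int.cast_sum, show (∑ δ ∈ (36 : ℕ).divisors, expFn [(2, 1), (4, 1), (18, -1), (36, -1)] δ) = 0 by decide, Int.cast_zero]

/-- `Σ_{δ∣36} r_δ(y) = 0` read in `ℂ`. [folklore] -/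
theorem sum_expFn_y_cast : ∑ δ ∈ (36 : ℕ).divisors, ((expFn [(6, 2), (12, 2), (18, -2), (36, -2)] δ : ℤ) : ℂ) = 0 := by
  rw [← Int.cast_sum, show (∑ δ ∈ (36 : ℕ).divisors, expFn [(6, 2), (12, 2), (18, -2), (36, -2)] δ) = 0 by decide, Int.cast_zero]

/-- The logarithmic-derivative form of `𝓔` spelled out: `G = 2E₂(2τ) + 4E₂(4τ) − 18E₂(18τ) − 36E₂(36τ)`. [cite: Zagier2008, §2.3] -/
theorem e2Comb_E_eq (τ : ℍ) :
    (∑ δ ∈ (36 : ℕ).divisors, ((expFn [(2, 1), (4, 1), (18, -1), (36, -1)] δ : ℤ) : ℂ) * (δ : ℂ) * E2 (sixMulPt δ τ))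
      = 2 * E2 (sixMulPt 2 τ) + 4 * E2 (sixMulPt 4 τ) - 18 * E2 (sixMulPt 18 τ) - 36 * E2 (sixMulPt 36 τ) := by
  rw [divisors_thirtySix, Finset.sum_insert (by decide), Finset.sum_insert (by decide), Finset.sum_insert (by decide),
    Finset.sum_insert (by decide), Finset.sum_insert (by decide), Finset.sum_insert (by decide), Finset.sum_insert (by decide),
    Finset.sum_insert (by decide), Finset.sum_singleton]
  rw [show expFn [(2, 1), (4, 1), (18, -1), (36, -1)] 1 = 0 by decide, show expFn [(2, 1), (4, 1), (18, -1), (36, -1)] 2 = 1 by decide, show expFn [(2, 1), (4, 1), (18, -1), (36, -1)] 3 = 0 by decide,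
    show expFn [(2, 1), (4, 1), (18, -1), (36, -1)] 4 = 1 by decide, show expFn [(2, 1), (4, 1), (18, -1), (36, -1)] 6 = 0 by decide, show expFn [(2, 1), (4, 1), (18, -1), (36, -1)] 9 = 0 by decide,
    show expFn [(2, 1), (4, 1), (18, -1), (36, -1)] 12 = 0 by decide, show expFn [(2, 1), (4, 1), (18, -1), (36, -1)] 18 = -1 by decide, show expFn [(2, 1), (4, 1), (18, -1), (36, -1)] 36 = -1 by decide]
  push_cast
  ring

/-- The logarithmic-derivative form of `y` spelled out: `G_y = 12E₂(6τ) + 24E₂(12τ) − 36E₂(18τ) − 72E₂(36τ)`. [cite: Zagier2008, §2.3] -/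
theorem e2Comb_y_eq (τ : ℍ) :
    (∑ δ ∈ (36 : ℕ).divisors, ((expFn [(6, 2), (12, 2), (18, -2), (36, -2)] δ : ℤ) : ℂ) * (δ : ℂ) * E2 (sixMulPt δ τ))
      = 12 * E2 (sixMulPt 6 τ) + 24 * E2 (sixMulPt 12 τ) - 36 * E2 (sixMulPt 18 τ) - 72 * E2 (sixMulPt 36 τ) := by
  rw [divisors_thirtySix, Finset.sum_insert (by decide), Finset.sum_insert (by decide), Finset.sum_insert (by decide),
    Finset.sum_insert (by decide), Finset.sum_insert (by decide), Finset.sum_insert (by decide), Finset.sum_insert (by decide),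
    Finset.sum_insert (by decide), Finset.sum_singleton]
  rw [show expFn [(6, 2), (12, 2), (18, -2), (36, -2)] 1 = 0 by decide, show expFn [(6, 2), (12, 2), (18, -2), (36, -2)] 2 = 0 by decide, show expFn [(6, 2), (12, 2), (18, -2), (36, -2)] 3 = 0 by decide,
    show expFn [(6, 2), (12, 2), (18, -2), (36, -2)] 4 = 0 by decide, show expFn [(6, 2), (12, 2), (18, -2), (36, -2)] 6 = 2 by decide, show expFn [(6, 2), (12, 2), (18, -2), (36, -2)] 9 = 0 by decide,
    show expFn [(6, 2), (12, 2), (18, -2), (36, -2)] 12 = 2 by decide, show expFn [(6, 2), (12, 2), (18, -2), (36, -2)] 18 = -2 by decide, show expFn [(6, 2), (12, 2), (18, -2), (36, -2)] 36 = -2 by decide]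
  push_cast
  ring

/-- **`G = 2E₂(2τ) + 4E₂(4τ) − 18E₂(18τ) − 36E₂(36τ) ∈ M₂(Γ₀(36))`** (`Σ r_δ = 0`). [cite: DiamondShurman2005, §1.2] -/
theorem exists_modularForm_G : ∃ G : ModularForm (Gamma0 36) 2,
    ∀ τ : ℍ, G τ = 2 * E2 (sixMulPt 2 τ) + 4 * E2 (sixMulPt 4 τ) - 18 * E2 (sixMulPt 18 τ) - 36 * E2 (sixMulPt 36 τ) := by
  obtain ⟨G, hG⟩ := exists_modularForm_e2Comb 36 (fun δ ↦ ((expFn [(2, 1), (4, 1), (18, -1), (36, -1)] δ : ℤ) : ℂ)) sum_expFn_E_cast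
  exact ⟨G, fun τ ↦ (hG τ).trans (e2Comb_E_eq τ)⟩

/-- **`G_y = 12E₂(6τ) + 24E₂(12τ) − 36E₂(18τ) − 72E₂(36τ) ∈ M₂(Γ₀(36))`.** [cite: DiamondShurman2005, §1.2] -/
theorem exists_modularForm_Gy : ∃ G : ModularForm (Gamma0 36) 2,
    ∀ τ : ℍ, G τ = 12 * E2 (sixMulPt 6 τ) + 24 * E2 (sixMulPt 12 τ) - 36 * E2 (sixMulPt 18 τ) - 72 * E2 (sixMulPt 36 τ) := by
  obtain ⟨G, hG⟩ := exists_modularForm_e2Comb 36 (fun δ ↦ ((expFn [(6, 2), (12, 2), (18, -2), (36, -2)] δ : ℤ) : ℂ)) sum_expFn_y_cast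
  exact ⟨G, fun τ ↦ (hG τ).trans (e2Comb_y_eq τ)⟩

/-! ## §2 Sturm's bound in `M₂(Γ₀(36))`: `F = o(q¹³) ⟹ F = 0` -/

/-- **`F ∈ M₂(Γ₀(36))` with `F/q¹³ → 0` at `i∞` vanishes** (`⌊2·72/12⌋ = 12 < 13`). [cite: DiamondShurman2005, Thm. 3.5.1] -/
theorem modularForm_thirtySix_eq_zero_of_tendsto (F : ModularForm (Gamma0 36) 2)
    (h : Tendsto (fun τ : ℍ ↦ F τ / Function.Periodic.qParam 1 (τ : ℂ) ^ 13) atImInfty (𝓝 0)) : (⇑F) = 0 := by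
  have hcard : Nat.card (𝒮ℒ ⧸ ((Gamma0 36 : Subgroup SL(2, ℤ)) : Subgroup (GL (Fin 2) ℝ)).subgroupOf 𝒮ℒ) = 72 := by
    rw [card_quotient_subgroupOf_eq_index]
    have h1 := index_gamma0_eq_gamma0Index_holds 36
    unfold index_gamma0_eq_gamma0Index at h1
    rw [h1, gamma0_data_36.1]
  refine coe_eq_zero_of_isBigO_exp' F (m := 13) ?_ (by
    rw [hcard]
    simp only [Int.reduceMul, Int.reduceToNat, Nat.reduceDiv, Nat.cast_ofNat]
    norm_num)
  have h1 : (fun τ : ℍ ↦ F τ / Function.Periodic.qParam 1 (τ : ℂ) ^ 13) =O[atImInfty] fun _ : ℍ ↦ (1 : ℝ) := h.isBigO_one ℝ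
  have h2 : (fun τ : ℍ ↦ Function.Periodic.qParam 1 (τ : ℂ) ^ 13) =O[atImInfty] fun τ : ℍ ↦ Real.exp (-2 * π * 13 * τ.im) := by
    refine Asymptotics.IsBigO.of_bound 1 (Filter.Eventually.of_forall fun τ ↦ ?_)
    rw [norm_pow, Function.Periodic.norm_qParam, Real.norm_eq_abs, abs_of_pos (Real.exp_pos _), one_mul,
      ← Real.exp_nat_mul, UpperHalfPlane.coe_im]
    apply le_of_eq
    congr 1
    push_cast
    ring
  have h3 := h1.mul h2
  simp only [one_mul] at h3
  refine h3.congr' (Filter.Eventually.of_forall fun τ ↦ ?_) Filter.EventuallyEq.rfl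
  exact div_mul_cancel₀ _ (pow_ne_zero _ (qParam_ne_zero τ))

end Summit.BirchSwinnertonDyer.BirchSwinnertonDyer.Theorems.ManinLocalTwoThree.LevelThirtySixFormsSeventyTwo

end
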